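import Mathlib.GroupTheory.Perm.Cycle.Basic
import Mathlib.GroupTheory.FreeGroup.Basic
import Mathlib.Dynamics.PeriodicPts.Defs
import Mathlib.Tactic.Group
import HarnessLib

/-!
# Darts of a one-vertex ribbon graph: face permutation, boundary words, products along cycles

Topic `Literature/GroupTheory/CombinatorialGroupTheory`.  The combinatorial model of an
orientable ribbon graph (fat graph) with ONE vertex and edge set `E`: its darts (half-edges) are
`E × Bool` (`(e, true)` = the edge `e` traversed positively, `(e, false)` = negatively), the
edge involution is `flip (e, b) = (e, !b)`, a *rotation* is a permutation `ρ` of the darts (the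
cyclic order of the half-edges around the vertex; "one vertex" = `ρ` transitive), and the
*face* (boundary) permutation is `face ρ := ρ ∘ flip` — a boundary walk leaving along the dart `d`
arrives through `flip d` and leaves next along `ρ (flip d)`.  The boundary cycles of the thickened
surface are the cycles of `face ρ`; read in the free group `F(E)` through `letter (e, b) = e^{±1}`
they are the *boundary words*.

Contents: `flip`, `letter`, `face`; `IsTransitive`; products along an orbit `prodFrom σ ℓ x n =
ℓ x · ℓ (σ x) ⋯ ℓ (σ^{n-1} x)` and the cycle product `cycleProd σ ℓ x` (over the minimal period),
with: splitting (`prodFrom_add`), agreement of two permutations along a stretch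
(`pow_apply_eq_of_forall_step`, `prodFrom_congr_perm`), conjugation along the cycle
(`cycleProd_apply_eq_conj`, `exists_cycleProd_eq_conj_of_sameCycle`), transport along an
equivariant injection (`prodFrom_map_of_semiconj`), and minimal periods of permutations of finite
types (`minimalPeriod_perm_pos`, `pow_minimalPeriod_perm`, `pow_apply_ne_of_lt_minimalPeriod`).
Pure bookkeeping; standard (e.g. Lando–Zvonkin, *Graphs on Surfaces and their Applications*
(2004), §1.3 "combinatorial maps"; Mohar–Thomassen, *Graphs on Surfaces* (2001), §3.2).  No
topology is formalised: the ribbon graph IS the pair (`E`, `ρ`).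
-/

namespace Literature.GroupTheory.CombinatorialGroupTheory

namespace RibbonGraph

open Equiv Equiv.Perm Function

universe u v

/-! ### Darts, the edge involution, letters, the face permutation -/

/-- The darts (oriented half-edges) of a one-vertex ribbon graph with edge set `E`:
`(e, true)` is the edge `e` read positively, `(e, false)` negatively. [cite: ZieschangVogtColdewey1980, 3.1.1–3.1.2] -/
abbrev Dart (E : Type u) : Type u := E × Bool

variable {E : Type u}

/-- The edge involution on darts: reverse the orientation. [cite: ZieschangVogtColdewey1980, 3.1.1–3.1.2] -/
def flip : Perm (Dart E) where
  toFun d := (d.1, !d.2)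
  invFun d := (d.1, !d.2)
  left_inv d := by simp
  right_inv d := by simp

/-- `flip_apply`: bookkeeping lemma of this construction (see the module docstring). [cite: ZieschangVogtColdewey1980, 3.1.1–3.1.2] -/
@[simp] theorem flip_apply (d : Dart E) : flip d = (d.1, !d.2) := rfl

/-- `flip_flip`: bookkeeping lemma of this construction (see the module docstring). [cite: ZieschangVogtColdewey1980, 3.1.1–3.1.2] -/
@[simp] theorem flip_flip (d : Dart E) : flip (flip d) = d := by simp

/-- `flip_ne_self`: bookkeeping lemma of this construction (see the module docstring). [cite: ZieschangVogtColdewey1980, 3.1.1–3.1.2] -/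
theorem flip_ne_self (d : Dart E) : flip d ≠ d := by
  rcases d with ⟨e, b⟩; cases b <;> simp

/-- `flip_symm`: bookkeeping lemma of this construction (see the module docstring). [cite: ZieschangVogtColdewey1980, 3.1.1–3.1.2] -/
@[simp] theorem flip_symm : (flip : Perm (Dart E)).symm = flip := rfl

/-- The letter of a dart in the free group on the edges: `(e, true) ↦ e`, `(e, false) ↦ e⁻¹`.
[cite: ZieschangVogtColdewey1980, 3.1.1–3.1.2] -/
def letter (d : Dart E) : FreeGroup E := FreeGroup.mk [d]

/-- `letter_true`: bookkeeping lemma of this construction (see the module docstring). [cite: ZieschangVogtColdewey1980, 3.1.1–3.1.2] -/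
@[simp] theorem letter_true (e : E) : letter (e, true) = FreeGroup.of e := rfl

/-- `letter_false`: bookkeeping lemma of this construction (see the module docstring). [cite: ZieschangVogtColdewey1980, 3.1.1–3.1.2] -/
@[simp] theorem letter_false (e : E) : letter (e, false) = (FreeGroup.of e)⁻¹ := rfl

/-- `letter_flip`: bookkeeping lemma of this construction (see the module docstring). [cite: ZieschangVogtColdewey1980, 3.1.1–3.1.2] -/
theorem letter_flip (d : Dart E) : letter (flip d) = (letter d)⁻¹ := by
  rcases d with ⟨e, b⟩; cases b <;> simp

/-- The face (boundary) permutation of the rotation `ρ`: leave along `d`, arrive through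
`flip d`, leave next along `ρ (flip d)`. [cite: ZieschangVogtColdewey1980, 3.1.1–3.1.2] -/
def face (ρ : Perm (Dart E)) : Perm (Dart E) := ρ * flip

/-- `face_apply`: bookkeeping lemma of this construction (see the module docstring). [cite: ZieschangVogtColdewey1980, 3.1.1–3.1.2] -/
@[simp] theorem face_apply (ρ : Perm (Dart E)) (d : Dart E) : face ρ d = ρ (flip d) := rfl

/-- `apply_eq_face_flip`: bookkeeping lemma of this construction (see the module docstring). [cite: ZieschangVogtColdewey1980, 3.1.1–3.1.2] -/
theorem apply_eq_face_flip (ρ : Perm (Dart E)) (d : Dart E) : ρ d = face ρ (flip d) := by simp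

/-! ### Transitive permutations ("one vertex") -/

/-- A permutation is *transitive* if it has a single cycle through every point. [cite: ZieschangVogtColdewey1980, 3.1.1–3.1.2] -/
def IsTransitive {α : Type v} (σ : Perm α) : Prop := ∀ x y : α, σ.SameCycle x y

/-! ### Minimal periods of a permutation of a finite type -/

section Period

variable {α : Type v} (σ : Perm α)

/-- `pow_apply_eq_iterate`: bookkeeping lemma of this construction (see the module docstring). [cite: ZieschangVogtColdewey1980, 3.1.1–3.1.2] -/
theorem pow_apply_eq_iterate (n : ℕ) (x : α) : (σ ^ n) x = (⇑σ)^[n] x := by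
  rw [Equiv.Perm.iterate_eq_pow]

/-- `σ ^ (minimal period) x = x`. [cite: ZieschangVogtColdewey1980, 3.1.1–3.1.2] -/
theorem pow_minimalPeriod_perm (x : α) : (σ ^ minimalPeriod σ x) x = x := by
  rw [pow_apply_eq_iterate]; exact isPeriodicPt_minimalPeriod σ x

/-- The iterates below the minimal period do not return. [cite: ZieschangVogtColdewey1980, 3.1.1–3.1.2] -/
theorem pow_apply_ne_of_lt_minimalPeriod {x : α} {k : ℕ} (hk0 : 0 < k) (hk : k < minimalPeriod σ x) :
    (σ ^ k) x ≠ x := by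
  intro h
  rw [pow_apply_eq_iterate] at h
  exact (IsPeriodicPt.minimalPeriod_le hk0 h).not_gt hk

variable [Finite α]

/-- Every point of a permutation of a finite type is periodic. [cite: ZieschangVogtColdewey1980, 3.1.1–3.1.2] -/
theorem mem_periodicPts_perm (x : α) : x ∈ periodicPts σ := by
  classical
  haveI := Fintype.ofFinite α
  refine ⟨orderOf σ, orderOf_pos σ, ?_⟩
  show (⇑σ)^[orderOf σ] x = x
  rw [← pow_apply_eq_iterate, pow_orderOf_eq_one, Perm.one_apply]

/-- The minimal period of a point under a permutation of a finite type is positive. [cite: ZieschangVogtColdewey1980, 3.1.1–3.1.2] -/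
theorem minimalPeriod_perm_pos (x : α) : 0 < minimalPeriod σ x :=
  minimalPeriod_pos_of_mem_periodicPts (mem_periodicPts_perm σ x)

/-- The iterates below the minimal period are pairwise distinct. [cite: ZieschangVogtColdewey1980, 3.1.1–3.1.2] -/
theorem pow_apply_injOn_lt_minimalPeriod {x : α} {i j : ℕ} (hi : i < minimalPeriod σ x)
    (hj : j < minimalPeriod σ x) (h : (σ ^ i) x = (σ ^ j) x) : i = j := by
  wlog hij : i ≤ j generalizing i j
  · exact (this hj hi h.symm (le_of_not_ge hij)).symm
  obtain ⟨d, rfl⟩ := Nat.exists_eq_add_of_le hij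
  rcases Nat.eq_zero_or_pos d with rfl | hd
  · rfl
  · exfalso
    have h' : (σ ^ d) ((σ ^ i) x) = (σ ^ i) x := by
      rw [← Perm.mul_apply, ← pow_add, add_comm]; exact h.symm
    have hper : minimalPeriod σ ((σ ^ i) x) = minimalPeriod σ x := by
      rw [pow_apply_eq_iterate]; exact minimalPeriod_apply_iterate (mem_periodicPts_perm σ x) i
    exact pow_apply_ne_of_lt_minimalPeriod σ hd (by rw [hper]; omega) h'

/-- `SameCycle` through the powers below the minimal period. [cite: ZieschangVogtColdewey1980, 3.1.1–3.1.2] -/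
theorem exists_lt_minimalPeriod_of_sameCycle {x y : α} (h : σ.SameCycle x y) :
    ∃ k < minimalPeriod σ x, (σ ^ k) x = y := by
  obtain ⟨n, rfl⟩ := h.exists_nat_pow_eq
  refine ⟨n % minimalPeriod σ x, Nat.mod_lt _ (minimalPeriod_perm_pos σ x), ?_⟩
  rw [pow_apply_eq_iterate, pow_apply_eq_iterate, iterate_mod_minimalPeriod_eq]

/-- The minimal period is constant along a cycle. [cite: ZieschangVogtColdewey1980, 3.1.1–3.1.2] -/
theorem minimalPeriod_eq_of_sameCycle {x y : α} (h : σ.SameCycle x y) :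
    minimalPeriod σ y = minimalPeriod σ x := by
  obtain ⟨n, rfl⟩ := h.exists_nat_pow_eq
  rw [pow_apply_eq_iterate]; exact minimalPeriod_apply_iterate (mem_periodicPts_perm σ x) n

end Period

/-! ### Agreement of two permutations along a stretch of an orbit -/

section Agree

variable {α : Type v} (σ τ : Perm α)

/-- If `τ` agrees with `σ` at the points `x, σ x, …, σ^{n-2} x`, then `τ^k x = σ^k x` for all
`k < n`. [cite: ZieschangVogtColdewey1980, 3.1.1–3.1.2] -/
theorem pow_apply_eq_of_forall_step {x : α} {n : ℕ}
    (h : ∀ k, k + 1 < n → τ ((σ ^ k) x) = (σ ^ (k + 1)) x) :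
    ∀ k < n, (τ ^ k) x = (σ ^ k) x := by
  intro k hk
  induction k with
  | zero => simp
  | succ k ih =>
    rw [pow_succ', Perm.mul_apply, ih (by omega), h k (by omega)]

end Agree

/-! ### Products along an orbit -/

section Prod

variable {α : Type v} {G : Type*} [Monoid G]

/-- `prodFrom σ ℓ x n = ℓ x · ℓ (σ x) ⋯ ℓ (σ^{n-1} x)`: the product of the labels of the first
`n` points of the `σ`-orbit of `x`. [cite: ZieschangVogtColdewey1980, 3.1.1–3.1.2] -/
def prodFrom (σ : Perm α) (ℓ : α → G) (x : α) (n : ℕ) : G :=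
  (List.ofFn fun k : Fin n => ℓ ((σ ^ (k : ℕ)) x)).prod

/-- `prodFrom_zero`: bookkeeping lemma of this construction (see the module docstring). [cite: ZieschangVogtColdewey1980, 3.1.1–3.1.2] -/
@[simp] theorem prodFrom_zero (σ : Perm α) (ℓ : α → G) (x : α) : prodFrom σ ℓ x 0 = 1 := by
  simp [prodFrom]

/-- `prodFrom_succ`: bookkeeping lemma of this construction (see the module docstring). [cite: ZieschangVogtColdewey1980, 3.1.1–3.1.2] -/
theorem prodFrom_succ (σ : Perm α) (ℓ : α → G) (x : α) (n : ℕ) :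
    prodFrom σ ℓ x (n + 1) = ℓ x * prodFrom σ ℓ (σ x) n := by
  simp only [prodFrom, List.ofFn_succ, List.prod_cons, Fin.val_zero, pow_zero, Perm.one_apply,
    Fin.val_succ, pow_succ, Perm.mul_apply]

/-- `prodFrom_one`: bookkeeping lemma of this construction (see the module docstring). [cite: ZieschangVogtColdewey1980, 3.1.1–3.1.2] -/
@[simp] theorem prodFrom_one (σ : Perm α) (ℓ : α → G) (x : α) : prodFrom σ ℓ x 1 = ℓ x := by
  rw [prodFrom_succ, prodFrom_zero, mul_one]

/-- `prodFrom_add`: bookkeeping lemma of this construction (see the module docstring). [cite: ZieschangVogtColdewey1980, 3.1.1–3.1.2] -/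
theorem prodFrom_add (σ : Perm α) (ℓ : α → G) (x : α) (m n : ℕ) :
    prodFrom σ ℓ x (m + n) = prodFrom σ ℓ x m * prodFrom σ ℓ ((σ ^ m) x) n := by
  induction m generalizing x with
  | zero => simp
  | succ m ih =>
    rw [Nat.succ_add, prodFrom_succ, prodFrom_succ, ih, mul_assoc, pow_succ, Perm.mul_apply]

/-- `prodFrom_succ'`: bookkeeping lemma of this construction (see the module docstring). [cite: ZieschangVogtColdewey1980, 3.1.1–3.1.2] -/
theorem prodFrom_succ' (σ : Perm α) (ℓ : α → G) (x : α) (n : ℕ) :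
    prodFrom σ ℓ x (n + 1) = prodFrom σ ℓ x n * ℓ ((σ ^ n) x) := by
  rw [prodFrom_add, prodFrom_one]

/-- Products along a stretch where `τ` agrees with `σ`. [cite: ZieschangVogtColdewey1980, 3.1.1–3.1.2] -/
theorem prodFrom_congr_perm (σ τ : Perm α) (ℓ : α → G) {x : α} {n : ℕ}
    (h : ∀ k, k + 1 < n → τ ((σ ^ k) x) = (σ ^ (k + 1)) x) :
    prodFrom τ ℓ x n = prodFrom σ ℓ x n := by
  unfold prodFrom
  congr 1
  exact List.ofFn_inj.mpr (funext fun k => congrArg ℓ (pow_apply_eq_of_forall_step σ τ h k k.2))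

/-- Products along an orbit transported along an equivariant map and a monoid homomorphism.
[cite: ZieschangVogtColdewey1980, 3.1.1–3.1.2] -/
theorem prodFrom_map_of_semiconj {β : Type*} {H : Type*} [Monoid H] (σ : Perm α) (τ : Perm β)
    (ι : α → β) (hι : ∀ a, ι (σ a) = τ (ι a)) (ℓ : α → G) (ℓ' : β → H) (f : G →* H)
    (hℓ : ∀ a, f (ℓ a) = ℓ' (ι a)) (x : α) (n : ℕ) :
    f (prodFrom σ ℓ x n) = prodFrom τ ℓ' (ι x) n := by
  induction n generalizing x with
  | zero => simp
  | succ n ih => rw [prodFrom_succ, prodFrom_succ, map_mul, hℓ, ih, hι]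

end Prod


/-! ### Permutations shifting a finite sequence cyclically -/

section CyclicSeq

variable {α : Type v} {G : Type*} [Monoid G]

/-- If `ψ (w k) = w (k+1)` for `k + 1 < N`, then `ψ^k (w 0) = w k` for `k < N`. [cite: ZieschangVogtColdewey1980, 3.1.1–3.1.2] -/
theorem pow_apply_eq_seq (ψ : Perm α) (w : ℕ → α) {N : ℕ}
    (hstep : ∀ k, k + 1 < N → ψ (w k) = w (k + 1)) : ∀ k < N, (ψ ^ k) (w 0) = w k := by
  intro k hk
  induction k with
  | zero => simp
  | succ k ih => rw [pow_succ', Perm.mul_apply, ih (by omega), hstep k hk]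

/-- The product along the first `N` points of the orbit of `w 0` is the product of the `ℓ (w k)`.
[cite: ZieschangVogtColdewey1980, 3.1.1–3.1.2] -/
theorem prodFrom_eq_of_seq (ψ : Perm α) (ℓ : α → G) (w : ℕ → α) {N : ℕ}
    (hstep : ∀ k, k + 1 < N → ψ (w k) = w (k + 1)) :
    prodFrom ψ ℓ (w 0) N = (List.ofFn fun k : Fin N => ℓ (w k)).prod := by
  unfold prodFrom
  congr 1
  exact List.ofFn_inj.mpr (funext fun k => congrArg ℓ (pow_apply_eq_seq ψ w hstep k k.2))

/-- A permutation shifting an injective sequence `w 0, …, w (N-1)` cyclically has minimal period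
`N` at `w 0`. [cite: ZieschangVogtColdewey1980, 3.1.1–3.1.2] -/
theorem minimalPeriod_eq_of_cyclicSeq (ψ : Perm α) (w : ℕ → α) {N : ℕ} (hN : 0 < N)
    (hstep : ∀ k, k + 1 < N → ψ (w k) = w (k + 1)) (hwrap : ψ (w (N - 1)) = w 0)
    (hinj : ∀ i j, i < N → j < N → w i = w j → i = j) : minimalPeriod ψ (w 0) = N := by
  have hret : (ψ ^ N) (w 0) = w 0 := by
    obtain ⟨M, rfl⟩ := Nat.exists_eq_add_one_of_ne_zero hN.ne'
    rw [pow_succ', Perm.mul_apply, pow_apply_eq_seq ψ w hstep M (by omega)]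
    simpa using hwrap
  have hper : IsPeriodicPt ψ N (w 0) := by
    show (⇑ψ)^[N] (w 0) = w 0
    rwa [← pow_apply_eq_iterate]
  have hle : minimalPeriod ψ (w 0) ≤ N := IsPeriodicPt.minimalPeriod_le hN hper
  have hpos : 0 < minimalPeriod ψ (w 0) := IsPeriodicPt.minimalPeriod_pos hN hper
  by_contra hne
  have hlt : minimalPeriod ψ (w 0) < N := lt_of_le_of_ne hle hne
  have hfix : (ψ ^ minimalPeriod ψ (w 0)) (w 0) = w 0 := pow_minimalPeriod_perm ψ (w 0)
  rw [pow_apply_eq_seq ψ w hstep _ hlt] at hfix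
  have := hinj _ 0 hlt hN hfix
  omega

/-- … and its cycle through `w 0` is `{w k : k < N}`. [cite: ZieschangVogtColdewey1980, 3.1.1–3.1.2] -/
theorem sameCycle_iff_of_cyclicSeq [Finite α] (ψ : Perm α) (w : ℕ → α) {N : ℕ} (hN : 0 < N)
    (hstep : ∀ k, k + 1 < N → ψ (w k) = w (k + 1)) (hwrap : ψ (w (N - 1)) = w 0)
    (hinj : ∀ i j, i < N → j < N → w i = w j → i = j) (y : α) :
    ψ.SameCycle (w 0) y ↔ ∃ k < N, w k = y := by
  constructor
  · intro h
    obtain ⟨k, hk, rfl⟩ := exists_lt_minimalPeriod_of_sameCycle ψ h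
    rw [minimalPeriod_eq_of_cyclicSeq ψ w hN hstep hwrap hinj] at hk
    exact ⟨k, hk, (pow_apply_eq_seq ψ w hstep k hk).symm⟩
  · rintro ⟨k, hk, rfl⟩
    rw [← pow_apply_eq_seq ψ w hstep k hk]
    exact (sameCycle_pow_right (f := ψ) (n := k)).2 SameCycle.rfl

end CyclicSeq

/-! ### The cycle product -/

section CycleProd

variable {α : Type v} [Finite α] {G : Type*} [Group G]

/-- The product of the labels once around the `σ`-cycle of `x`, starting at `x`. [cite: ZieschangVogtColdewey1980, 3.1.1–3.1.2] -/
noncomputable def cycleProd (σ : Perm α) (ℓ : α → G) (x : α) : G := prodFrom σ ℓ x (minimalPeriod σ x)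

/-- Moving the starting point one step along the cycle conjugates the cycle product by the first
label. [cite: ZieschangVogtColdewey1980, 3.1.1–3.1.2] -/
theorem cycleProd_apply_eq_conj (σ : Perm α) (ℓ : α → G) (x : α) :
    cycleProd σ ℓ (σ x) = (ℓ x)⁻¹ * cycleProd σ ℓ x * ℓ x := by
  unfold cycleProd
  have hp : minimalPeriod σ (σ x) = minimalPeriod σ x := by
    simpa using minimalPeriod_eq_of_sameCycle σ (SameCycle.rfl.apply_right (f := σ) (x := x))
  rw [hp]
  obtain ⟨p, hp'⟩ : ∃ p, minimalPeriod σ x = p + 1 :=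
    Nat.exists_eq_add_one_of_ne_zero (minimalPeriod_perm_pos σ x).ne'
  rw [hp', prodFrom_succ' σ ℓ (σ x) p, prodFrom_succ σ ℓ x p]
  have hret : (σ ^ p) (σ x) = x := by
    rw [← Perm.mul_apply, ← pow_succ, ← hp']; exact pow_minimalPeriod_perm σ x
  rw [hret]; group

/-- Along a cycle the cycle products are conjugate, by an explicit element. [cite: ZieschangVogtColdewey1980, 3.1.1–3.1.2] -/
theorem exists_cycleProd_eq_conj_of_sameCycle (σ : Perm α) (ℓ : α → G) {x y : α}
    (h : σ.SameCycle x y) : ∃ c : G, cycleProd σ ℓ y = c⁻¹ * cycleProd σ ℓ x * c := by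
  obtain ⟨n, rfl⟩ := h.exists_nat_pow_eq
  clear h
  induction n with
  | zero => exact ⟨1, by simp⟩
  | succ n ih =>
    obtain ⟨c, hc⟩ := ih
    refine ⟨c * ℓ ((σ ^ n) x), ?_⟩
    rw [pow_succ', Perm.mul_apply, cycleProd_apply_eq_conj, hc]
    group

/-- If `τ` agrees with `σ` on the whole `σ`-cycle of `x`, the two cycles through `x` coincide
pointwise, have the same length and the same cycle product. [cite: ZieschangVogtColdewey1980, 3.1.1–3.1.2] -/
theorem cycleProd_congr_perm (σ τ : Perm α) (ℓ : α → G) {x : α}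
    (h : ∀ y, σ.SameCycle x y → τ y = σ y) :
    minimalPeriod τ x = minimalPeriod σ x ∧ cycleProd τ ℓ x = cycleProd σ ℓ x ∧
      ∀ y, (τ.SameCycle x y ↔ σ.SameCycle x y) := by
  have step : ∀ k, τ ((σ ^ k) x) = (σ ^ (k + 1)) x := fun k => by
    rw [h _ ((sameCycle_pow_right (f := σ) (n := k)).2 SameCycle.rfl), pow_succ', Perm.mul_apply]
  have hpow : ∀ k, (τ ^ k) x = (σ ^ k) x := fun k =>
    pow_apply_eq_of_forall_step σ τ (n := k + 1) (fun j _ => step j) k (Nat.lt_succ_self k)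
  have hper : minimalPeriod τ x = minimalPeriod σ x := by
    apply le_antisymm
    · apply IsPeriodicPt.minimalPeriod_le (minimalPeriod_perm_pos σ x)
      show (⇑τ)^[minimalPeriod σ x] x = x
      rw [← pow_apply_eq_iterate, hpow]; exact pow_minimalPeriod_perm σ x
    · apply IsPeriodicPt.minimalPeriod_le (minimalPeriod_perm_pos τ x)
      show (⇑σ)^[minimalPeriod τ x] x = x
      rw [← pow_apply_eq_iterate, ← hpow]; exact pow_minimalPeriod_perm τ x
  refine ⟨hper, ?_, fun y => ⟨fun hy => ?_, fun hy => ?_⟩⟩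
  · unfold cycleProd
    rw [hper]
    exact prodFrom_congr_perm σ τ ℓ fun k _ => step k
  · obtain ⟨j, hj⟩ := hy.exists_nat_pow_eq
    rw [← hj, hpow j]
    exact (sameCycle_pow_right (f := σ) (n := j)).2 SameCycle.rfl
  · obtain ⟨j, hj⟩ := hy.exists_nat_pow_eq
    rw [← hj, ← hpow j]
    exact (sameCycle_pow_right (f := τ) (n := j)).2 SameCycle.rfl

end CycleProd

end RibbonGraph

end Literature.GroupTheory.CombinatorialGroupTheory
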